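import Literature.Computability.Cryptography.KitaevPhaseEstimationSums
import Literature.Computability.Cryptography.ShorOrderFindingAnalysis
import HarnessLib

/-!
# Period finding by eigenvalue estimation of shifts, I: the autocorrelation form of Parseval

Family `PQC` / quantum-advantage barrier `PPolyOracles`; groundwork for the discharge of the named
fact `Literature.Barriers.QuantumAdvantage.aaronsonChen2017_lem75_quantum`
(`Barriers/QuantumAdvantage/PPolyOraclesThm76.lean`: Aaronson–Chen 2017, Lemma 7.5 (2)–(3) and
App. 13 — "we can apply Boneh and Lipton's quantum period-finding algorithm to recover `a`").
Boneh–Lipton / Shor period finding of an `a`-periodic table `f` on `[0, Q)`, `Q = 2^L`, is realised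
in the tree's exact Clifford+T model along Kitaev's route (Hadamard tests of the controlled SHIFTS
`Z ↦ Z − 2^e (mod Q)` of a uniformly prepared index register `Z`, cf.
`KitaevPhaseEstimationCircuit.lean` for the modular-exponentiation analogue). Unlike modular
exponentiation, the shift of `[0, Q)` is only an *approximate* symmetry of `f` (`a ∤ Q`), so the
exact fibre regrouping `Kitaev1995.parseval_fibers` does not apply. This file proves its
replacement, an elementary finite Fourier identity:

* `corrMass Q F c = ∑_ω |∑_{v < Q, F v = ω} e^{2πi c v/Q}|²` — the *autocorrelation mass* of a
  table `F` on `[0, Q)` at the character `c` (Shor 1997, §5: for `F = g ∘ (· mod a)` with `g`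
  injective these are `Q² ∑_{k<a} P(c, k)` with Shor's `P(c,k) = outcomeProb Q a k c`,
  `corrMass_periodic`; for an injective table they are the constant `Q`, `corrMass_of_injOn`);
  `corrMass_nonneg`, `sum_corrMass` (total mass `Q²`);
* `card_shift_eq` — the number of `v < Q` with `F v = F (v + δ mod Q)` is
  `Q⁻¹ ∑_c corrMass(c) e^{2πi c δ/Q}` (Wiener–Khinchin over `ℤ/Q`);
* **`parseval_shift`** — for tables `F_u` on `[0, Q_u)`, exponents `A_u : Y → ℤ` and a fibre map
  `R Z y` identifying exactly the `y, y'` with `F_u (Z_u − A_u y mod Q_u) = F_u (Z_u − A_u y' mod Q_u)`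
  for all units `u`: `∑_Z ∑_ω |∑_{R Z y = ω} φ y|² = (∏_u Q_u⁻¹) ∑_c (∏_u corrMass_u (c_u))
  |∑_y φ y e^{2πi ∑_u c_u A_u(y)/Q_u}|²` — the outcome statistics of the shift experiment are a
  MIXTURE over the characters `c` (weights `corrMass/Q²`) of exact eigenvalue statistics
  (Kitaev 1995, §4, `P(h) = q⁻¹ ∑_{h'} P(h', h)`, here for a non-invariant initial state).

## References

* D. Boneh, R. J. Lipton, *Quantum cryptanalysis of hidden linear functions*, CRYPTO '95, LNCS 963
  (1995) 424–437 (period finding on `ℤ` by Fourier sampling), cited through [AaronsonChen2017].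
* P. W. Shor, SIAM J. Comput. 26 (1997) 1484–1509, §5, eqs. (5.5)–(5.7) [Shor1997].
* A. Yu. Kitaev, arXiv:quant-ph/9511026 (1995), §3–§4 [Kitaev1995].
* S. Aaronson, L. Chen, CCC 2017 (arXiv:1612.05903), Lemma 7.5 and App. 13 [AaronsonChen2017].

## Tree

`Kitaev1995.sum_range_exp_two_pi_mul`, `Kitaev1995.ofReal_norm_sq_sum`,
`Kitaev1995.conj_exp_two_pi_mul_I` (`KitaevPhaseEstimationSums`), `Shor1997.outcomeProb`,
`Shor1997.norm_sq_amplitude_eq_outcomeProb` (`ShorOrderFindingAnalysis`, `ShorProofs`).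
All statements are [folklore] finite sums; the cites locate their role.
-/

noncomputable section

namespace Literature.Computability.Cryptography

namespace PeriodFinding

open Complex Finset Real Kitaev1995

/-! ### Characters of `ℤ/Q` -/

/-- The character `e^{2πi c v / Q}` of `ℤ/Q`. [folklore] -/
def chr (Q : ℕ) (c v : ℤ) : ℂ := cexp (2 * π * I * ((c : ℂ) * v / Q))

/-- `chr` unfolded (the shape of `Kitaev1995.sum_range_exp_two_pi_mul`). [folklore] -/
theorem chr_def (Q : ℕ) (c v : ℤ) : chr Q c v = cexp (2 * π * I * ((c : ℂ) * v / Q)) := rfl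

/-- `chr` is multiplicative in the argument. [folklore] -/
theorem chr_add (Q : ℕ) (c v w : ℤ) : chr Q c (v + w) = chr Q c v * chr Q c w := by
  unfold chr
  rw [← Complex.exp_add]
  congr 1
  push_cast
  ring

/-- The conjugate of a character value is the value at the opposite argument. [folklore] -/
theorem conj_chr (Q : ℕ) (c v : ℤ) : (starRingEnd ℂ) (chr Q c v) = chr Q c (-v) := by
  unfold chr
  have h := conj_exp_two_pi_mul_I ((c : ℝ) * v / Q)
  push_cast at h ⊢
  rw [h]
  congr 1
  ring

/-- Character values have norm one. [folklore] -/
theorem norm_chr (Q : ℕ) (c v : ℤ) : ‖chr Q c v‖ = 1 := by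
  rw [chr, show 2 * π * I * ((c : ℂ) * v / Q) = ((2 * π * ((c : ℝ) * v / Q) : ℝ) : ℂ) * I by
    push_cast; ring]
  exact Complex.norm_exp_ofReal_mul_I _

/-- **Orthogonality** in the shape used below: `∑_{c<Q} chr Q c m = Q · [Q ∣ m]`. [folklore] -/
theorem sum_chr (Q : ℕ) (hQ : 0 < Q) (m : ℤ) :
    ∑ c ∈ range Q, chr Q c m = if (Q : ℤ) ∣ m then (Q : ℂ) else 0 :=
  sum_range_exp_two_pi_mul Q hQ m

variable {Ω : Type*} [DecidableEq Ω]

/-! ### The autocorrelation mass of a table -/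

/-- **The autocorrelation mass** of the table `F` on `[0, Q)` at the character `c`:
`corrMass Q F c = ∑_{ω} |∑_{v < Q, F v = ω} e^{2πi c v / Q}|²`, the total power at frequency `c`
of the level sets of `F` (for Shor's periodic tables, `Q²` times the probability of observing `c`,
`corrMass_periodic`). [cite: Shor1997, §5 (eqs. (5.5)–(5.7))] -/
def corrMass (Q : ℕ) (F : ℕ → Ω) (c : ℤ) : ℝ :=
  ∑ ω ∈ (range Q).image F, ‖∑ v ∈ (range Q).filter (fun v => F v = ω), chr Q c v‖ ^ 2

/-- The autocorrelation mass is nonnegative. [folklore] -/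
theorem corrMass_nonneg (Q : ℕ) (F : ℕ → Ω) (c : ℤ) : 0 ≤ corrMass Q F c :=
  sum_nonneg fun _ _ => by positivity

/-- **The autocorrelation mass as a pair sum**:
`corrMass Q F c = ∑_{v, v' < Q, F v = F v'} e^{2πi c (v − v')/Q}` (as a complex number). [folklore] -/
theorem corrMass_eq_sum_pairs (Q : ℕ) (F : ℕ → Ω) (c : ℤ) :
    ((corrMass Q F c : ℝ) : ℂ) =
      ∑ v ∈ range Q, ∑ v' ∈ range Q, if F v = F v' then chr Q c ((v : ℤ) - v') else 0 := by
  unfold corrMass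
  rw [Complex.ofReal_sum]
  simp_rw [ofReal_norm_sq_sum]
  symm
  rw [← sum_fiberwise_of_maps_to (s := range Q) (t := (range Q).image F) (g := F)
    (fun v hv => mem_image_of_mem F hv)]
  refine sum_congr rfl fun ω _ => sum_congr rfl fun v hv => ?_
  rw [sum_filter]
  refine sum_congr rfl fun v' _ => ?_
  have hFv : F v = ω := (mem_filter.1 hv).2
  by_cases h : F v = F v'
  · rw [if_pos h, if_pos (h ▸ hFv), conj_chr, ← chr_add]
    rfl
  · rw [if_neg h, if_neg (fun h' => h (hFv.trans h'.symm))]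

/-- For `v, v' < Q`: `Q ∣ v − v'` iff `v' = v`. [folklore] -/
theorem dvd_sub_iff_eq {Q v v' : ℕ} (hv : v < Q) (hv' : v' < Q) :
    (Q : ℤ) ∣ (v : ℤ) - v' ↔ v' = v := by
  constructor
  · rintro ⟨t, ht⟩
    have ht0 : t = 0 := by
      rcases lt_trichotomy t 0 with h | h | h
      · nlinarith
      · exact h
      · nlinarith
    subst ht0
    simp only [mul_zero] at ht
    omega
  · rintro rfl
    simp

/-- **Total autocorrelation mass**: `∑_{c < Q} corrMass Q F c = Q²`. [folklore] -/
theorem sum_corrMass (Q : ℕ) (hQ : 0 < Q) (F : ℕ → Ω) :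
    ∑ c ∈ range Q, corrMass Q F c = (Q : ℝ) ^ 2 := by
  apply Complex.ofReal_injective
  rw [Complex.ofReal_sum]
  simp_rw [corrMass_eq_sum_pairs]
  rw [sum_comm]
  have key : ∀ v ∈ range Q, (∑ c ∈ range Q, ∑ v' ∈ range Q,
      if F v = F v' then chr Q c ((v : ℤ) - v') else 0) = Q := by
    intro v hv
    rw [sum_comm]
    have inner : ∀ v' ∈ range Q, (∑ c ∈ range Q,
        if F v = F v' then chr Q c ((v : ℤ) - v') else 0) = if v' = v then (Q : ℂ) else 0 := by
      intro v' hv'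
      have hvQ : v < Q := mem_range.1 hv
      have hv'Q : v' < Q := mem_range.1 hv'
      by_cases hF : F v = F v'
      · simp_rw [if_pos hF]
        rw [sum_chr Q hQ]
        by_cases hvv : v' = v
        · rw [if_pos ((dvd_sub_iff_eq hvQ hv'Q).2 hvv), if_pos hvv]
        · rw [if_neg (fun h => hvv ((dvd_sub_iff_eq hvQ hv'Q).1 h)), if_neg hvv]
      · simp_rw [if_neg hF]
        rw [sum_const_zero, if_neg]
        rintro rfl
        exact hF rfl
    rw [sum_congr rfl inner, sum_ite_eq' (range Q) v (fun _ => (Q : ℂ)), if_pos hv]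
  rw [sum_congr rfl key, sum_const, card_range]
  push_cast
  ring

/-- **An injective table has constant autocorrelation mass `Q`** (every level set is a
singleton; for the shift experiment: a permutation table gives the uniform mixture over the
characters). [folklore] -/
theorem corrMass_of_injOn (Q : ℕ) (F : ℕ → Ω) (hF : Set.InjOn F (range Q : Set ℕ)) (c : ℤ) :
    corrMass Q F c = Q := by
  unfold corrMass
  have hfib : ∀ ω ∈ (range Q).image F,
      ‖∑ v ∈ (range Q).filter (fun v => F v = ω), chr Q c v‖ ^ 2 = 1 := by
    intro ω hω
    obtain ⟨v₀, hv₀, rfl⟩ := mem_image.1 hω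
    have hset : (range Q).filter (fun v => F v = F v₀) = {v₀} := by
      ext v
      simp only [mem_filter, mem_singleton]
      constructor
      · rintro ⟨hv, hFv⟩
        exact hF (mem_coe.2 hv) (mem_coe.2 hv₀) hFv
      · rintro rfl
        exact ⟨hv₀, rfl⟩
    rw [hset, sum_singleton, norm_chr, one_pow]
  rw [sum_congr rfl hfib, sum_const, nsmul_eq_mul, mul_one, card_image_of_injOn hF, card_range]

/-- **The autocorrelation mass of a periodic table is Shor's outcome probability**
(Shor 1997, §5, (5.5)–(5.7)): if `F v = g (v mod a)` with `g` injective on `[0, a)` and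
`0 < a ≤ Q`, then `corrMass Q F c = Q² ∑_{k < a} outcomeProb Q a k c`.
[cite: Shor1997, §5 (probability of observing |c, x^k mod n>)] -/
theorem corrMass_periodic (Q a : ℕ) (ha : 0 < a) (haQ : a ≤ Q) (g : ℕ → Ω)
    (hg : Set.InjOn g (range a : Set ℕ)) (c : ℕ) :
    corrMass Q (fun v => g (v % a)) c =
      (Q : ℝ) ^ 2 * ∑ k ∈ range a, Shor1997.outcomeProb Q a k c := by
  unfold corrMass
  -- the level sets are the residue classes
  have himg : (range Q).image (fun v => g (v % a)) = (range a).image g := by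
    ext ω
    simp only [mem_image, mem_range]
    constructor
    · rintro ⟨v, -, rfl⟩
      exact ⟨v % a, Nat.mod_lt v ha, rfl⟩
    · rintro ⟨k, hk, rfl⟩
      exact ⟨k, lt_of_lt_of_le hk haQ, by rw [Nat.mod_eq_of_lt hk]⟩
  rw [himg, sum_image fun k hk k' hk' h => hg (mem_coe.2 hk) (mem_coe.2 hk') h, mul_sum]
  refine sum_congr rfl fun k hk => ?_
  have hka : k < a := mem_range.1 hk
  have hkQ : k < Q := lt_of_lt_of_le hka haQ
  rw [← Shor1997.norm_sq_amplitude_eq_outcomeProb c hka hkQ]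
  have hfilter : (range Q).filter (fun v => g (v % a) = g k) =
      (range Q).filter (fun v => v % a = k) := by
    ext v
    simp only [mem_filter, mem_range, and_congr_right_iff]
    intro _
    constructor
    · intro h
      exact hg (mem_coe.2 (mem_range.2 (Nat.mod_lt v ha))) (mem_coe.2 hk) h
    · intro h
      rw [h]
  rw [hfilter, norm_mul, mul_pow]
  have hQn : ‖(1 / (Q : ℂ))‖ ^ 2 = 1 / (Q : ℝ) ^ 2 := by
    rw [norm_div, norm_one, Complex.norm_natCast, div_pow, one_pow]
  have hQr : (Q : ℝ) ^ 2 ≠ 0 := by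
    have : 0 < Q := lt_of_lt_of_le ha haQ
    positivity
  rw [hQn, ← mul_assoc, mul_one_div_cancel hQr, one_mul]
  congr 2
  refine sum_congr rfl fun v _ => ?_
  rw [chr]
  congr 1
  push_cast
  ring

/-! ### Autocorrelation counts (Wiener–Khinchin over `ℤ/Q`) -/

/-- Reduction of an integer modulo `Q` as a natural number in `[0, Q)`. [folklore] -/
def shiftMod (Q : ℕ) (z : ℤ) : ℕ := (z % (Q : ℤ)).toNat

/-- `shiftMod Q z < Q` for `0 < Q`. [folklore] -/
theorem shiftMod_lt {Q : ℕ} (hQ : 0 < Q) (z : ℤ) : shiftMod Q z < Q := by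
  unfold shiftMod
  have h1 : 0 ≤ z % (Q : ℤ) := Int.emod_nonneg _ (by exact_mod_cast hQ.ne')
  have h2 : z % (Q : ℤ) < Q := Int.emod_lt_of_pos _ (by exact_mod_cast hQ)
  omega

/-- The integer value of `shiftMod`. [folklore] -/
theorem shiftMod_coe {Q : ℕ} (hQ : 0 < Q) (z : ℤ) : ((shiftMod Q z : ℕ) : ℤ) = z % (Q : ℤ) := by
  unfold shiftMod
  exact Int.toNat_of_nonneg (Int.emod_nonneg _ (by exact_mod_cast hQ.ne'))

/-- `shiftMod` of a natural number below `Q`. [folklore] -/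
theorem shiftMod_natCast {Q v : ℕ} (hv : v < Q) : shiftMod Q (v : ℤ) = v := by
  apply Int.natCast_inj.1
  rw [shiftMod_coe (by omega), Int.emod_eq_of_lt (by omega) (by exact_mod_cast hv)]

/-- `shiftMod` respects addition modulo `Q`. [folklore] -/
theorem shiftMod_add {Q : ℕ} (hQ : 0 < Q) (z w : ℤ) :
    shiftMod Q ((shiftMod Q z : ℤ) + w) = shiftMod Q (z + w) := by
  apply Int.natCast_inj.1
  rw [shiftMod_coe hQ, shiftMod_coe hQ, shiftMod_coe hQ, Int.add_emod, Int.emod_emod_of_dvd _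
    (dvd_refl _), ← Int.add_emod]

/-- For `v' < Q`: `v' = shiftMod Q z` iff `Q ∣ z − v'`. [folklore] -/
theorem eq_shiftMod_iff {Q v' : ℕ} (hQ : 0 < Q) (hv' : v' < Q) (z : ℤ) :
    v' = shiftMod Q z ↔ (Q : ℤ) ∣ z - v' := by
  rw [← Int.natCast_inj, shiftMod_coe hQ]
  have h1 : (v' : ℤ) % Q = v' := Int.emod_eq_of_lt (by omega) (by exact_mod_cast hv')
  constructor
  · intro h
    have h2 : z ≡ v' [ZMOD Q] := by
      unfold Int.ModEq
      rw [h1]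
      exact h.symm
    exact (Int.modEq_iff_dvd.1 h2.symm)
  · intro h
    have h2 : (v' : ℤ) ≡ z [ZMOD Q] := (Int.modEq_iff_dvd.2 h)
    unfold Int.ModEq at h2
    rw [h1] at h2
    exact h2

/-- **Translation invariance of counts on `ℤ/Q`**: `z ↦ shiftMod Q (z − s)` permutes `[0, Q)`,
so a count over `z < Q` of a predicate of `shiftMod Q (z − s)` is the count of the predicate.
[folklore] -/
theorem card_filter_shift {Q : ℕ} (hQ : 0 < Q) (s : ℤ) (P : ℕ → Prop) [DecidablePred P] :
    ((range Q).filter fun z : ℕ => P (shiftMod Q ((z : ℤ) - s))).card =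
      ((range Q).filter P).card := by
  refine card_bij (fun (z : ℕ) _ => shiftMod Q ((z : ℤ) - s)) (fun z hz => ?_)
    (fun z hz z' hz' h => ?_) (fun v hv => ?_)
  · exact mem_filter.2 ⟨mem_range.2 (shiftMod_lt hQ _), (mem_filter.1 hz).2⟩
  · -- injectivity: `z − s ≡ z' − s (mod Q)` and `z, z' < Q`
    have hzQ : z < Q := mem_range.1 (mem_filter.1 hz).1
    have hz'Q : z' < Q := mem_range.1 (mem_filter.1 hz').1
    have h1 : ((z : ℤ) - s) % Q = ((z' : ℤ) - s) % Q := by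
      rw [← shiftMod_coe hQ, ← shiftMod_coe hQ, h]
    have h2 : (z : ℤ) - s + s ≡ (z' : ℤ) - s + s [ZMOD Q] := Int.ModEq.add_right s h1
    simp only [sub_add_cancel] at h2
    unfold Int.ModEq at h2
    rw [Int.emod_eq_of_lt (by omega) (by exact_mod_cast hzQ),
      Int.emod_eq_of_lt (by omega) (by exact_mod_cast hz'Q)] at h2
    exact_mod_cast h2
  · refine ⟨shiftMod Q ((v : ℤ) + s), mem_filter.2 ⟨mem_range.2 (shiftMod_lt hQ _), ?_⟩, ?_⟩
    · rw [show ((shiftMod Q ((v : ℤ) + s) : ℕ) : ℤ) - s = (shiftMod Q ((v : ℤ) + s) : ℤ) + (-s) by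
        ring, shiftMod_add hQ, show (v : ℤ) + s + -s = v by ring,
        shiftMod_natCast (mem_range.1 (mem_filter.1 hv).1)]
      exact (mem_filter.1 hv).2
    · rw [show ((shiftMod Q ((v : ℤ) + s) : ℕ) : ℤ) - s = (shiftMod Q ((v : ℤ) + s) : ℤ) + (-s) by
        ring, shiftMod_add hQ, show (v : ℤ) + s + -s = v by ring,
        shiftMod_natCast (mem_range.1 (mem_filter.1 hv).1)]

/-- The number of `v < Q` with `F v = F (v + δ mod Q)`. [folklore] -/
def shiftCount (Q : ℕ) (F : ℕ → Ω) (δ : ℤ) : ℕ :=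
  ((range Q).filter fun v : ℕ => F v = F (shiftMod Q ((v : ℤ) + δ))).card

/-- **Wiener–Khinchin over `ℤ/Q`**: the number of `v < Q` with `F v = F (v + δ mod Q)` is
`Q⁻¹ ∑_{c<Q} corrMass Q F c · e^{2πi c δ/Q}`. [folklore] -/
theorem shiftCount_eq {Q : ℕ} (hQ : 0 < Q) (F : ℕ → Ω) (δ : ℤ) :
    ((shiftCount Q F δ : ℕ) : ℂ) =
      (1 / (Q : ℂ)) * ∑ c ∈ range Q, (corrMass Q F c : ℂ) * chr Q c δ := by
  have hQ0 : (Q : ℂ) ≠ 0 := by exact_mod_cast hQ.ne'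
  -- both sides equal the triple sum `T`
  set T : ℂ := ∑ v ∈ range Q, ∑ v' ∈ range Q, ∑ c ∈ range Q,
    if F v = F v' then (1 / (Q : ℂ)) * chr Q c ((v : ℤ) + δ - v') else (0 : ℂ) with hT
  -- the count as a pair sum with a Kronecker delta modulo `Q`, expanded by orthogonality
  have hcount : ((shiftCount Q F δ : ℕ) : ℂ) = T := by
    unfold shiftCount
    rw [card_filter]
    push_cast
    refine sum_congr rfl fun v _ => ?_
    have step : ∀ v' ∈ range Q, (∑ c ∈ range Q,
        if F v = F v' then (1 / (Q : ℂ)) * chr Q c ((v : ℤ) + δ - v') else 0) =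
        if v' = shiftMod Q ((v : ℤ) + δ) then (if F v = F v' then (1 : ℂ) else 0) else 0 := by
      intro v' hv'
      have hiff := eq_shiftMod_iff hQ (mem_range.1 hv') ((v : ℤ) + δ)
      by_cases hF : F v = F v'
      · simp_rw [if_pos hF]
        rw [← mul_sum, sum_chr Q hQ]
        by_cases h1 : v' = shiftMod Q ((v : ℤ) + δ)
        · rw [if_pos (hiff.1 h1), if_pos h1]
          field_simp
        · rw [if_neg (fun h => h1 (hiff.2 h)), if_neg h1, mul_zero]
      · simp only [if_neg hF, sum_const_zero, ite_self]
    rw [sum_congr rfl step, sum_ite_eq' (range Q) (shiftMod Q ((v : ℤ) + δ))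
      (fun v' => if F v = F v' then (1 : ℂ) else 0), if_pos (mem_range.2 (shiftMod_lt hQ _))]
  -- the right-hand side
  have hright : (1 / (Q : ℂ)) * ∑ c ∈ range Q, (corrMass Q F c : ℂ) * chr Q c δ = T := by
    have h1 : ∀ c ∈ range Q, (1 / (Q : ℂ)) * ((corrMass Q F c : ℂ) * chr Q c δ) =
        ∑ v ∈ range Q, ∑ v' ∈ range Q,
          if F v = F v' then (1 / (Q : ℂ)) * chr Q c ((v : ℤ) + δ - v') else (0 : ℂ) := by
      intro c _
      rw [corrMass_eq_sum_pairs, sum_mul, mul_sum]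
      refine sum_congr rfl fun v _ => ?_
      rw [sum_mul, mul_sum]
      refine sum_congr rfl fun v' _ => ?_
      by_cases hF : F v = F v'
      · rw [if_pos hF, if_pos hF, show (v : ℤ) + δ - v' = ((v : ℤ) - v') + δ by ring, chr_add]
      · rw [if_neg hF, if_neg hF, zero_mul, mul_zero]
    rw [mul_sum, sum_congr rfl h1, hT]
    exact sum_comm.trans (sum_congr rfl fun v _ => sum_comm)
  rw [hcount, hright]

/-! ### The autocorrelation form of Parseval for the shift experiment -/

section Characters

variable {U : Type*} [Fintype U]

/-- The character of `∏_u ℤ/Q_u` attached to `c`, evaluated at an exponent vector `A`: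
`e^{2πi ∑_u c_u A_u / Q_u}`. [folklore] -/
def chrPi (Q : U → ℕ) (c : (u : U) → Fin (Q u)) (A : U → ℤ) : ℂ :=
  cexp (2 * π * I * ∑ u, ((c u : ℕ) : ℂ) * (A u : ℂ) / (Q u : ℂ))

/-- `chrPi` is the product of the one-unit characters. [folklore] -/
theorem chrPi_eq_prod (Q : U → ℕ) (c : (u : U) → Fin (Q u)) (A : U → ℤ) :
    chrPi Q c A = ∏ u, chr (Q u) (c u : ℕ) (A u) := by
  unfold chrPi chr
  rw [mul_sum, Complex.exp_sum]
  refine prod_congr rfl fun u _ => ?_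
  push_cast
  ring_nf

/-- `chrPi` at a difference of exponent vectors. [folklore] -/
theorem chrPi_sub (Q : U → ℕ) (c : (u : U) → Fin (Q u)) (A B : U → ℤ) :
    chrPi Q c (fun u => A u - B u) = chrPi Q c A * (starRingEnd ℂ) (chrPi Q c B) := by
  rw [chrPi_eq_prod, chrPi_eq_prod, chrPi_eq_prod, map_prod, ← prod_mul_distrib]
  refine prod_congr rfl fun u _ => ?_
  rw [conj_chr, ← chr_add]
  rfl

end Characters

/-- `‖∑ f‖²`, cast to `ℂ` after `push_cast`, as a double sum. [folklore] -/
theorem cast_norm_sq_sum {ι : Type*} (s : Finset ι) (f : ι → ℂ) :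
    ((‖∑ i ∈ s, f i‖ : ℝ) : ℂ) ^ 2 = ∑ i ∈ s, ∑ j ∈ s, f i * (starRingEnd ℂ) (f j) := by
  rw [← Complex.ofReal_pow]
  exact ofReal_norm_sq_sum s f

section Parseval

variable {U Y Ω' : Type*} [Fintype U] [DecidableEq U] [Fintype Y] [Fintype Ω'] [DecidableEq Ω']

/-- **Parseval in autocorrelation form for the shift experiment** (the replacement of
`Kitaev1995.parseval_fibers` when the measured register holds `F_u (Z_u − A_u(y) mod Q_u)` for a
uniformly random offset `Z`). If `R Z` identifies exactly the arguments `y, y'` whose shifted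
table values agree in every unit, then
`∑_Z ∑_ω |∑_{R Z y = ω} φ y|² = (∏_u Q_u⁻¹) ∑_c (∏_u corrMass_u(c_u)) |∑_y φ y χ_c(A(y))|²`:
a mixture over the characters `c` of `∏_u ℤ/Q_u`, with weights the autocorrelation masses, of the
squared character sums of the exact eigenvalue experiment.
[cite: Kitaev1995, §4 (P(h) = q^{-1} sum_{h'} P(h', h))] -/
theorem parseval_shift (Q : U → ℕ) (hQ : ∀ u, 0 < Q u) (F : U → ℕ → Ω) (A : U → Y → ℤ)
    (R : ((u : U) → Fin (Q u)) → Y → Ω')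
    (hR : ∀ Z y y', R Z y = R Z y' ↔
      ∀ u, F u (shiftMod (Q u) ((Z u : ℕ) - A u y)) = F u (shiftMod (Q u) ((Z u : ℕ) - A u y')))
    (φ : Y → ℂ) :
    ∑ Z : (u : U) → Fin (Q u), ∑ ω : Ω', ‖∑ y ∈ univ.filter (fun y => R Z y = ω), φ y‖ ^ 2 =
      (∏ u, (1 / (Q u : ℝ))) * ∑ c : (u : U) → Fin (Q u),
        (∏ u, corrMass (Q u) (F u) (c u : ℕ)) * ‖∑ y, φ y * chrPi Q c (fun u => A u y)‖ ^ 2 := by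
  classical
  -- Step 1: the left-hand side as `∑_{y, y'} φ y conj(φ y') · #{Z : R Z y' = R Z y}`
  have hL : (∑ Z : (u : U) → Fin (Q u), ∑ ω : Ω',
      ((‖∑ y ∈ univ.filter (fun y => R Z y = ω), φ y‖ : ℝ) : ℂ) ^ 2) =
      ∑ y, ∑ y', φ y * (starRingEnd ℂ) (φ y') *
        ∑ Z : (u : U) → Fin (Q u), if R Z y' = R Z y then 1 else 0 := by
    have step : ∀ Z : (u : U) → Fin (Q u), (∑ ω : Ω',
        ((‖∑ y ∈ univ.filter (fun y => R Z y = ω), φ y‖ : ℝ) : ℂ) ^ 2) =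
        ∑ y, ∑ y', if R Z y' = R Z y then φ y * (starRingEnd ℂ) (φ y') else 0 := by
      intro Z
      simp_rw [cast_norm_sq_sum]
      rw [show (∑ ω, ∑ y ∈ univ.filter (fun y => R Z y = ω),
            ∑ y' ∈ univ.filter (fun y => R Z y = ω), φ y * (starRingEnd ℂ) (φ y')) =
          ∑ ω, ∑ y ∈ univ.filter (fun y => R Z y = ω),
            ∑ y' ∈ univ.filter (fun y' => R Z y' = R Z y), φ y * (starRingEnd ℂ) (φ y') from
        sum_congr rfl fun ω _ => sum_congr rfl fun y hy => by rw [(mem_filter.1 hy).2]]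
      rw [sum_fiberwise univ (R Z) fun y => ∑ y' ∈ univ.filter (fun y' => R Z y' = R Z y),
        φ y * (starRingEnd ℂ) (φ y')]
      refine sum_congr rfl fun y _ => ?_
      rw [sum_filter]
    rw [sum_congr rfl fun Z _ => step Z, sum_comm]
    refine sum_congr rfl fun y _ => ?_
    rw [sum_comm]
    refine sum_congr rfl fun y' _ => ?_
    rw [mul_sum]
    refine sum_congr rfl fun Z _ => ?_
    split_ifs <;> simp
  -- Step 2: the count over `Z` factorises over the units into shift counts
  have hcountZ : ∀ y y' : Y,
      (∑ Z : (u : U) → Fin (Q u), (if R Z y' = R Z y then (1 : ℂ) else 0)) =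
        ∏ u, ((shiftCount (Q u) (F u) (A u y - A u y') : ℕ) : ℂ) := by
    intro y y'
    have hind : ∀ Z : (u : U) → Fin (Q u), (if R Z y' = R Z y then (1 : ℂ) else 0) =
        ∏ u, (if F u (shiftMod (Q u) ((Z u : ℕ) - A u y')) =
          F u (shiftMod (Q u) ((Z u : ℕ) - A u y)) then (1 : ℂ) else 0) := by
      intro Z
      by_cases h : R Z y' = R Z y
      · rw [if_pos h]
        exact (prod_eq_one fun u _ => if_pos (((hR Z y' y).1 h) u)).symm
      · rw [if_neg h]
        obtain ⟨u, hu⟩ := not_forall.1 (fun h' => h ((hR Z y' y).2 h'))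
        exact (prod_eq_zero (mem_univ u) (if_neg hu)).symm
    rw [sum_congr rfl fun Z _ => hind Z, ← Fintype.piFinset_univ,
      ← Finset.prod_univ_sum (fun u => (univ : Finset (Fin (Q u))))
        (fun u (z : Fin (Q u)) => if F u (shiftMod (Q u) ((z : ℕ) - A u y')) =
          F u (shiftMod (Q u) ((z : ℕ) - A u y)) then (1 : ℂ) else 0)]
    refine prod_congr rfl fun u _ => ?_
    rw [Fin.sum_univ_eq_sum_range (fun z : ℕ => if F u (shiftMod (Q u) ((z : ℤ) - A u y')) =
        F u (shiftMod (Q u) ((z : ℤ) - A u y)) then (1 : ℂ) else 0) (Q u), sum_boole]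
    unfold shiftCount
    rw [← card_filter_shift (hQ u) (A u y)
      (fun v : ℕ => F u v = F u (shiftMod (Q u) ((v : ℤ) + (A u y - A u y'))))]
    congr 2
    refine filter_congr fun (z : ℕ) _ => ?_
    rw [shiftMod_add (hQ u), show (z : ℤ) - A u y + (A u y - A u y') = (z : ℤ) - A u y' by ring,
      eq_comm]
  -- Step 3: expand the shift counts (`shiftCount_eq`) and exchange `∏_u ∑_{c_u}` for `∑_c ∏_u`
  have hprodsum : ∀ y y' : Y, (∏ u, ((shiftCount (Q u) (F u) (A u y - A u y') : ℕ) : ℂ)) =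
      ∑ c : (u : U) → Fin (Q u), ∏ u, (1 / (Q u : ℂ)) *
        ((corrMass (Q u) (F u) (c u : ℕ) : ℂ) * chr (Q u) (c u : ℕ) (A u y - A u y')) := by
    intro y y'
    simp_rw [shiftCount_eq (hQ _)]
    rw [← Fintype.piFinset_univ, ← Finset.prod_univ_sum (fun u => (univ : Finset (Fin (Q u))))
      (fun u (c : Fin (Q u)) => (1 / (Q u : ℂ)) *
        ((corrMass (Q u) (F u) (c : ℕ) : ℂ) * chr (Q u) (c : ℕ) (A u y - A u y')))]
    refine prod_congr rfl fun u _ => ?_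
    rw [mul_sum, Fin.sum_univ_eq_sum_range (fun c : ℕ => (1 / (Q u : ℂ)) *
      ((corrMass (Q u) (F u) c : ℂ) * chr (Q u) c (A u y - A u y'))) (Q u)]
  -- Step 4: cast to `ℂ`, bring the sum over `c` outside and identify the summands
  apply Complex.ofReal_injective
  push_cast
  rw [hL]
  simp_rw [hcountZ, hprodsum, mul_sum]
  refine (sum_congr rfl fun y _ => Finset.sum_comm).trans ?_
  rw [Finset.sum_comm]
  refine sum_congr rfl fun c _ => ?_
  rw [cast_norm_sq_sum, mul_sum, mul_sum]
  refine sum_congr rfl fun y _ => ?_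
  rw [mul_sum, mul_sum]
  refine sum_congr rfl fun y' _ => ?_
  rw [prod_mul_distrib, prod_mul_distrib, ← chrPi_eq_prod, chrPi_sub, map_mul]
  ring

end Parseval

end PeriodFinding

end Literature.Computability.Cryptography

end
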